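import Literature.Topology.FourManifolds.CappedBallLid
import Literature.Topology.FourManifolds.CollarFill
import Literature.Topology.FourManifolds.SmoothMax
import HarnessLib

/-!
# Polar kit about an axis point: capped polar graphs of a horizontal plane and of a vertical cylinder

Topic `Literature/Topology/FourManifolds`; infrastructure for the "headless sub-ball" and the
"can model" of the fact seat of Alexander's theorem
(`provefact-Literature.Topology.FourManifolds.SphereEmbedding.schoenflies_exists_ball`,
Schultens (2014), Thm. 3.2.5).  **Everything in this file is proved; the definitions are
explicit formulas (no named facts).**

About the axis point `p₀ = (0, 0, z₀)` of `ℝ³` we use `R(x) = ‖x - p₀‖`, the vertical cosine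
`vc(x) = (x₂ - z₀)/R` and the squared horizontal sine `hs(x) = hsq(x)/R²` (`vc² + hs = 1`).  The
horizontal plane `{x₂ = z₀ + d}` is the polar graph `R = d / vc` over the directions with
`vc > 0`, and the vertical cylinder `{hsq = ρ₁²}` is the polar graph `R = ρ₁ / √hs` off the
axis; capping the denominators from below by the smooth `capFun c` (`= t` for `t ≥ c`, values
in `[c/2, c]` for `t ≤ c`) makes both graphs smooth positive functions on `{x ≠ p₀}`:
`planePolar z₀ d c` and `cylPolar z₀ ρ₁ c`.

## References
* J. Schultens, *Introduction to 3-Manifolds*, GSM 151 (2014), Thm. 3.2.5, Lemma 3.2.3.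
-/

open scoped RealInnerProductSpace Topology ContDiff
open Set Filter Metric Function

noncomputable section

namespace Literature.Topology.FourManifolds

namespace CappedBallLid

/-! ### §1 The capping function -/

/-- `capFun c t = t + (c - t)(1 - λ((2t - c)/c))` (`λ` the smooth transition): equal to `t` for
`t ≥ c`, to `c` for `t ≤ c/2`, with values in `[c/2, c]` on `t ≤ c`. [folklore] -/
def capFun (c t : ℝ) : ℝ := t + (c - t) * (1 - Real.smoothTransition ((2 * t - c) / c))

/-- `capFun c` is smooth. [folklore] -/
theorem contDiff_capFun (c : ℝ) : ContDiff ℝ ∞ (capFun c) := by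
  unfold capFun
  exact contDiff_id.add ((contDiff_const.sub contDiff_id).mul (contDiff_const.sub
    (Real.smoothTransition.contDiff.comp (((contDiff_const.mul contDiff_id).sub contDiff_const).div_const _))))

/-- `capFun c t = t` for `t ≥ c > 0`. [folklore] -/
theorem capFun_eq_self {c t : ℝ} (hc : 0 < c) (h : c ≤ t) : capFun c t = t := by
  unfold capFun
  rw [Real.smoothTransition.one_of_one_le ((one_le_div hc).2 (by linarith))]
  ring

/-- `capFun c t = c` for `t ≤ c/2`, `c > 0`. [folklore] -/
theorem capFun_eq_const {c t : ℝ} (hc : 0 < c) (h : t ≤ c / 2) : capFun c t = c := by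
  unfold capFun
  rw [Real.smoothTransition.zero_of_nonpos (div_nonpos_of_nonpos_of_nonneg (by linarith) hc.le)]
  ring

/-- `c/2 ≤ capFun c t` for `c > 0`. [folklore] -/
theorem half_le_capFun {c : ℝ} (hc : 0 < c) (t : ℝ) : c / 2 ≤ capFun c t := by
  unfold capFun
  have h0 := Real.smoothTransition.nonneg ((2 * t - c) / c)
  have h1 := Real.smoothTransition.le_one ((2 * t - c) / c)
  by_cases ht : c / 2 ≤ t
  · by_cases ht' : t ≤ c
    · nlinarith
    · push Not at ht'
      rw [Real.smoothTransition.one_of_one_le ((one_le_div hc).2 (by linarith))]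
      linarith
  · push Not at ht
    rw [Real.smoothTransition.zero_of_nonpos (div_nonpos_of_nonpos_of_nonneg (by linarith) hc.le)]
    linarith

/-- `capFun c t ≤ c` for `t ≤ c`, `c > 0`. [folklore] -/
theorem capFun_le {c t : ℝ} (h : t ≤ c) : capFun c t ≤ c := by
  unfold capFun
  have h0 := Real.smoothTransition.nonneg ((2 * t - c) / c)
  have h1 := Real.smoothTransition.le_one ((2 * t - c) / c)
  nlinarith

/-- `capFun c t` is positive for `c > 0`. [folklore] -/
theorem capFun_pos {c : ℝ} (hc : 0 < c) (t : ℝ) : 0 < capFun c t :=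
  lt_of_lt_of_le (by linarith) (half_le_capFun hc t)

/-- `t ≤ capFun c t` for `t ≤ c`. [folklore] -/
theorem le_capFun {c t : ℝ} (h : t ≤ c) : t ≤ capFun c t := by
  unfold capFun
  have h1 := Real.smoothTransition.le_one ((2 * t - c) / c)
  nlinarith

/-! ### §2 Polar coordinates about an axis point -/

/-- The axis point `p₀ = (0, 0, z₀)`. [folklore] -/
def axisPt (z₀ : ℝ) : (EuclideanSpace ℝ (Fin 3)) := z₀ • EuclideanSpace.single 2 1

/-- Coordinates of the axis point. [folklore] -/
@[simp] theorem axisPt_apply_two (z₀ : ℝ) : axisPt z₀ 2 = z₀ := by simp [axisPt]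

/-- Coordinates of the axis point. [folklore] -/
@[simp] theorem axisPt_apply_zero (z₀ : ℝ) : axisPt z₀ 0 = 0 := by simp [axisPt]

/-- Coordinates of the axis point. [folklore] -/
@[simp] theorem axisPt_apply_one (z₀ : ℝ) : axisPt z₀ 1 = 0 := by simp [axisPt]

/-- `hsq` is unchanged by an axial translation. [folklore] -/
theorem hsq_sub_axisPt (z₀ : ℝ) (x : (EuclideanSpace ℝ (Fin 3))) : hsq (x - axisPt z₀) = hsq x := by
  simp [hsq]

/-- The polar radius `R(x) = ‖x - p₀‖`. [folklore] -/
def prad (z₀ : ℝ) (x : (EuclideanSpace ℝ (Fin 3))) : ℝ := ‖x - axisPt z₀‖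

/-- `R² = hsq + (x₂ - z₀)²`. [folklore] -/
theorem prad_sq (z₀ : ℝ) (x : (EuclideanSpace ℝ (Fin 3))) : prad z₀ x ^ 2 = hsq x + (x 2 - z₀) ^ 2 := by
  unfold prad
  rw [norm_sq_eq_hsq_add, hsq_sub_axisPt]
  simp

/-- `R` is smooth off `p₀`. [folklore] -/
theorem contDiffAt_prad {z₀ : ℝ} {x : (EuclideanSpace ℝ (Fin 3))} (hx : x ≠ axisPt z₀) : ContDiffAt ℝ ∞ (prad z₀) x := by
  unfold prad
  exact (contDiffAt_id.sub contDiffAt_const).norm ℝ (sub_ne_zero.2 hx)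

/-- `R > 0` off `p₀`. [folklore] -/
theorem prad_pos {z₀ : ℝ} {x : (EuclideanSpace ℝ (Fin 3))} (hx : x ≠ axisPt z₀) : 0 < prad z₀ x :=
  norm_pos_iff.2 (sub_ne_zero.2 hx)

/-- `|x₂ - z₀| ≤ R`. [folklore] -/
theorem abs_sub_le_prad (z₀ : ℝ) (x : (EuclideanSpace ℝ (Fin 3))) : |x 2 - z₀| ≤ prad z₀ x := by
  have h := prad_sq z₀ x
  have hh : 0 ≤ hsq x := hsq_nonneg x
  have hR : 0 ≤ prad z₀ x := norm_nonneg _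
  exact abs_le_of_sq_le_sq' (by nlinarith) hR |> fun h' => abs_sub_comm (x 2) z₀ ▸ (abs_le.2 ⟨by linarith [h'.1], h'.2⟩)

/-- `hsq ≤ R²`. [folklore] -/
theorem hsq_le_prad_sq (z₀ : ℝ) (x : (EuclideanSpace ℝ (Fin 3))) : hsq x ≤ prad z₀ x ^ 2 := by
  rw [prad_sq]; nlinarith

/-- A point above `p₀` is not `p₀`. [folklore] -/
theorem ne_axisPt_of_lt {z₀ : ℝ} {x : (EuclideanSpace ℝ (Fin 3))} (h : z₀ < x 2) : x ≠ axisPt z₀ := by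
  rintro rfl; simp at h

/-- The vertical cosine `vc(x) = (x₂ - z₀)/R`. [folklore] -/
def vcos (z₀ : ℝ) (x : (EuclideanSpace ℝ (Fin 3))) : ℝ := (x 2 - z₀) / prad z₀ x

/-- The squared horizontal sine `hs(x) = hsq(x)/R²`. [folklore] -/
def hsin2 (z₀ : ℝ) (x : (EuclideanSpace ℝ (Fin 3))) : ℝ := hsq x / prad z₀ x ^ 2

/-- `vc² + hs = 1` off `p₀`. [folklore] -/
theorem vcos_sq_add_hsin2 {z₀ : ℝ} {x : (EuclideanSpace ℝ (Fin 3))} (hx : x ≠ axisPt z₀) :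
    vcos z₀ x ^ 2 + hsin2 z₀ x = 1 := by
  have hR := prad_pos hx
  unfold vcos hsin2
  rw [div_pow, ← add_div, div_eq_one_iff_eq (by positivity), prad_sq]
  ring

/-- `vc` is smooth off `p₀`. [folklore] -/
theorem contDiffAt_vcos {z₀ : ℝ} {x : (EuclideanSpace ℝ (Fin 3))} (hx : x ≠ axisPt z₀) : ContDiffAt ℝ ∞ (vcos z₀) x := by
  unfold vcos
  exact ((contDiff_coord 2).contDiffAt.sub contDiffAt_const).div (contDiffAt_prad hx) (prad_pos hx).ne'

/-- `hs` is smooth off `p₀`. [folklore] -/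
theorem contDiffAt_hsin2 {z₀ : ℝ} {x : (EuclideanSpace ℝ (Fin 3))} (hx : x ≠ axisPt z₀) : ContDiffAt ℝ ∞ (hsin2 z₀) x := by
  unfold hsin2
  exact contDiff_hsq.contDiffAt.div ((contDiffAt_prad hx).pow 2) (pow_ne_zero _ (prad_pos hx).ne')

/-- `|vc| ≤ 1`. [folklore] -/
theorem abs_vcos_le_one (z₀ : ℝ) (x : (EuclideanSpace ℝ (Fin 3))) : |vcos z₀ x| ≤ 1 := by
  unfold vcos
  by_cases hx : x = axisPt z₀
  · subst hx; simp [prad]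
  · rw [abs_div, abs_of_pos (prad_pos hx), div_le_one (prad_pos hx)]
    exact abs_sub_le_prad z₀ x

/-- `0 ≤ hs ≤ 1`. [folklore] -/
theorem hsin2_mem_Icc (z₀ : ℝ) (x : (EuclideanSpace ℝ (Fin 3))) : hsin2 z₀ x ∈ Icc (0 : ℝ) 1 := by
  unfold hsin2
  refine ⟨div_nonneg (hsq_nonneg x) (sq_nonneg _), ?_⟩
  by_cases h0 : prad z₀ x = 0
  · rw [h0]; simp
  · exact (div_le_one (by positivity)).2 (hsq_le_prad_sq z₀ x)

/-! ### §3 The capped polar graphs of the plane and of the cylinder -/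

/-- **Polar graph of the horizontal plane `{x₂ = z₀ + d}`**, capped:
`T̃(x) = d / capFun c (vc x)`; equal to `d / vc` where `vc ≥ c`. [folklore] -/
def planePolar (z₀ d c : ℝ) (x : (EuclideanSpace ℝ (Fin 3))) : ℝ := d / capFun c (vcos z₀ x)

/-- **Polar graph of the vertical cylinder `{hsq = ρ₁²}`**, capped:
`g̃(x) = ρ₁ / √(capFun c (hs x))`; equal to `ρ₁ R / √hsq` where `hs ≥ c`. [folklore] -/
def cylPolar (z₀ ρ₁ c : ℝ) (x : (EuclideanSpace ℝ (Fin 3))) : ℝ := ρ₁ / Real.sqrt (capFun c (hsin2 z₀ x))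

variable {z₀ d c c' ρ₁ : ℝ}

/-- `T̃` is smooth off `p₀` (`c > 0`). [folklore] -/
theorem contDiffAt_planePolar (hc : 0 < c) {x : (EuclideanSpace ℝ (Fin 3))} (hx : x ≠ axisPt z₀) :
    ContDiffAt ℝ ∞ (planePolar z₀ d c) x := by
  unfold planePolar
  exact contDiffAt_const.div ((contDiff_capFun c).contDiffAt.comp x (contDiffAt_vcos hx))
    (capFun_pos hc _).ne'

/-- `g̃` is smooth off `p₀` (`c > 0`). [folklore] -/
theorem contDiffAt_cylPolar (hc : 0 < c') {x : (EuclideanSpace ℝ (Fin 3))} (hx : x ≠ axisPt z₀) :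
    ContDiffAt ℝ ∞ (cylPolar z₀ ρ₁ c') x := by
  unfold cylPolar
  refine contDiffAt_const.div ?_ (Real.sqrt_pos.2 (capFun_pos hc _)).ne'
  exact ((contDiff_capFun c').contDiffAt.comp x (contDiffAt_hsin2 hx)).sqrt (capFun_pos hc _).ne'

/-- `T̃ > 0` for `d, c > 0`. [folklore] -/
theorem planePolar_pos (hd : 0 < d) (hc : 0 < c) (x : (EuclideanSpace ℝ (Fin 3))) : 0 < planePolar z₀ d c x :=
  div_pos hd (capFun_pos hc _)

/-- `g̃ > 0` for `ρ₁, c > 0`. [folklore] -/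
theorem cylPolar_pos (hρ : 0 < ρ₁) (hc : 0 < c') (x : (EuclideanSpace ℝ (Fin 3))) : 0 < cylPolar z₀ ρ₁ c' x :=
  div_pos hρ (Real.sqrt_pos.2 (capFun_pos hc _))

/-- **The plane as a polar graph**: where `vc ≥ c` (so `x₂ > z₀`), `R ≤ T̃ ↔ x₂ ≤ z₀ + d` and
`R < T̃ ↔ x₂ < z₀ + d`. [folklore] -/
theorem prad_le_planePolar_iff (hc : 0 < c) {x : (EuclideanSpace ℝ (Fin 3))} (hx : x ≠ axisPt z₀)
    (hvc : c ≤ vcos z₀ x) :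
    (prad z₀ x ≤ planePolar z₀ d c x ↔ x 2 ≤ z₀ + d) ∧
    (prad z₀ x < planePolar z₀ d c x ↔ x 2 < z₀ + d) := by
  have hR := prad_pos hx
  have hvpos : 0 < vcos z₀ x := lt_of_lt_of_le hc hvc
  have hz : 0 < x 2 - z₀ := by
    unfold vcos at hvpos
    exact (div_pos_iff_of_pos_right hR).1 hvpos
  unfold planePolar
  rw [capFun_eq_self hc hvc]
  unfold vcos
  rw [div_div_eq_mul_div, le_div_iff₀ hz, lt_div_iff₀ hz]
  constructor
  · constructor
    · intro h; nlinarith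
    · intro h; nlinarith
  · constructor
    · intro h; nlinarith
    · intro h; nlinarith

/-- **The cylinder as a polar graph**: where `hs ≥ c` (so off the axis), `R ≤ g̃ ↔ hsq ≤ ρ₁²`
and `R < g̃ ↔ hsq < ρ₁²` (`ρ₁ > 0`). [folklore] -/
theorem prad_le_cylPolar_iff (hρ : 0 < ρ₁) (hc : 0 < c') {x : (EuclideanSpace ℝ (Fin 3))} (hx : x ≠ axisPt z₀)
    (hhs : c' ≤ hsin2 z₀ x) :
    (prad z₀ x ≤ cylPolar z₀ ρ₁ c' x ↔ hsq x ≤ ρ₁ ^ 2) ∧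
    (prad z₀ x < cylPolar z₀ ρ₁ c' x ↔ hsq x < ρ₁ ^ 2) := by
  have hR := prad_pos hx
  have hhpos : 0 < hsq x := by
    have : 0 < hsin2 z₀ x := lt_of_lt_of_le hc hhs
    unfold hsin2 at this
    exact (div_pos_iff_of_pos_right (by positivity)).1 this
  unfold cylPolar
  rw [capFun_eq_self hc hhs]
  unfold hsin2
  rw [Real.sqrt_div' _ (sq_nonneg _), Real.sqrt_sq hR.le, div_div_eq_mul_div]
  have hsq_pos : 0 < Real.sqrt (hsq x) := Real.sqrt_pos.2 hhpos
  rw [le_div_iff₀ hsq_pos, lt_div_iff₀ hsq_pos]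
  have e1 : prad z₀ x * Real.sqrt (hsq x) ≤ ρ₁ * prad z₀ x ↔ Real.sqrt (hsq x) ≤ ρ₁ := by
    rw [mul_comm ρ₁]; exact mul_le_mul_iff_of_pos_left hR
  have e2 : prad z₀ x * Real.sqrt (hsq x) < ρ₁ * prad z₀ x ↔ Real.sqrt (hsq x) < ρ₁ := by
    rw [mul_comm ρ₁]; exact mul_lt_mul_iff_of_pos_left hR
  rw [e1, e2]
  constructor
  · rw [Real.sqrt_le_left hρ.le]
  · rw [Real.sqrt_lt' hρ]

/-! ### §4 The rounded profile `smin(g̃, T̃)` -/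

/-- **The rounded polar profile** `R_prof = g̃ - δᵣ P((g̃ - T̃)/δᵣ)`: the smooth minimum of the
cylinder graph `g̃` and the plane graph `T̃` (`P` an admissible smooth positive part as in
`SmoothMax.lean`): it is `g̃` where `g̃ ≤ T̃ - δᵣ`, `T̃` where `T̃ ≤ g̃ - δᵣ`, and always in
`[min g̃ T̃ - δᵣ, min g̃ T̃]`. [folklore] -/
def polarProfile (P : ℝ → ℝ) (z₀ d ρ₁ c c' δᵣ : ℝ) (x : (EuclideanSpace ℝ (Fin 3))) : ℝ :=
  cylPolar z₀ ρ₁ c' x - δᵣ * P ((cylPolar z₀ ρ₁ c' x - planePolar z₀ d c x) / δᵣ)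

variable {P : ℝ → ℝ} {δᵣ : ℝ}

/-- `R_prof` is smooth off `p₀`. [folklore] -/
theorem contDiffAt_polarProfile (hP : ContDiff ℝ ∞ P) (hc : 0 < c) (hc' : 0 < c')
    {x : (EuclideanSpace ℝ (Fin 3))} (hx : x ≠ axisPt z₀) :
    ContDiffAt ℝ ∞ (polarProfile P z₀ d ρ₁ c c' δᵣ) x := by
  unfold polarProfile
  exact (contDiffAt_cylPolar hc' hx).sub (contDiffAt_const.mul (hP.contDiffAt.comp x
    (((contDiffAt_cylPolar hc' hx).sub (contDiffAt_planePolar hc hx)).div_const _)))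

/-- `R_prof = g̃` where `g̃ ≤ T̃ - δᵣ`. [folklore] -/
theorem polarProfile_eq_cylPolar (hP0 : ∀ t, t ≤ -1 → P t = 0) (hδ : 0 < δᵣ) {x : (EuclideanSpace ℝ (Fin 3))}
    (h : cylPolar z₀ ρ₁ c' x ≤ planePolar z₀ d c x - δᵣ) :
    polarProfile P z₀ d ρ₁ c c' δᵣ x = cylPolar z₀ ρ₁ c' x := by
  unfold polarProfile
  rw [hP0 _ (by rw [div_le_iff₀ hδ]; linarith), mul_zero, sub_zero]

/-- `R_prof = T̃` where `T̃ ≤ g̃ - δᵣ`. [folklore] -/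
theorem polarProfile_eq_planePolar (hP1 : ∀ t, 1 ≤ t → P t = t) (hδ : 0 < δᵣ) {x : (EuclideanSpace ℝ (Fin 3))}
    (h : planePolar z₀ d c x ≤ cylPolar z₀ ρ₁ c' x - δᵣ) :
    polarProfile P z₀ d ρ₁ c c' δᵣ x = planePolar z₀ d c x := by
  unfold polarProfile
  rw [hP1 _ (by rw [le_div_iff₀ hδ]; linarith), mul_div_cancel₀ _ hδ.ne']
  ring

/-- `min g̃ T̃ - δᵣ ≤ R_prof ≤ min g̃ T̃`. [folklore] -/
theorem polarProfile_mem_Icc (hPge : ∀ t, max 0 t ≤ P t) (hPle : ∀ t, P t ≤ max 0 t + 1)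
    (hδ : 0 < δᵣ) (x : (EuclideanSpace ℝ (Fin 3))) :
    polarProfile P z₀ d ρ₁ c c' δᵣ x ∈
      Icc (min (cylPolar z₀ ρ₁ c' x) (planePolar z₀ d c x) - δᵣ)
        (min (cylPolar z₀ ρ₁ c' x) (planePolar z₀ d c x)) := by
  unfold polarProfile
  set g := cylPolar z₀ ρ₁ c' x
  set T := planePolar z₀ d c x
  have h1 := SmoothMax.max_le_smax hPge hδ (-g) (-T)
  have h2 := SmoothMax.smax_le_max_add hPle hδ (-g) (-T)
  have e : (-T - -g) = g - T := by ring
  rw [e] at h1 h2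
  rw [max_neg_neg] at h1 h2
  constructor <;> linarith

/-- `R_prof > 0` when `g̃, T̃ > δᵣ`. [folklore] -/
theorem polarProfile_pos (hPge : ∀ t, max 0 t ≤ P t) (hPle : ∀ t, P t ≤ max 0 t + 1)
    (hδ : 0 < δᵣ) {x : (EuclideanSpace ℝ (Fin 3))} (hg : δᵣ < cylPolar z₀ ρ₁ c' x) (hT : δᵣ < planePolar z₀ d c x) :
    0 < polarProfile P z₀ d ρ₁ c c' δᵣ x := by
  have h := (polarProfile_mem_Icc hPge hPle hδ x (z₀ := z₀) (d := d) (ρ₁ := ρ₁) (c := c) (c' := c')).1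
  have : δᵣ < min (cylPolar z₀ ρ₁ c' x) (planePolar z₀ d c x) := lt_min hg hT
  linarith


/-! ### §5 Radial derivatives: `R` has radial derivative `R`, the polar graphs have radial derivative `0` -/

/-- Points of the ray: `p₀ + t (x - p₀)`. [folklore] -/
theorem ray_sub_axisPt (z₀ t : ℝ) (x : (EuclideanSpace ℝ (Fin 3))) :
    axisPt z₀ + t • (x - axisPt z₀) - axisPt z₀ = t • (x - axisPt z₀) := by abel

/-- `R(p₀ + t(x - p₀)) = t R(x)` for `t ≥ 0`. [folklore] -/
theorem prad_ray (z₀ : ℝ) {t : ℝ} (ht : 0 ≤ t) (x : (EuclideanSpace ℝ (Fin 3))) :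
    prad z₀ (axisPt z₀ + t • (x - axisPt z₀)) = t * prad z₀ x := by
  unfold prad
  rw [ray_sub_axisPt, norm_smul, Real.norm_eq_abs, abs_of_nonneg ht]

/-- `hsq(p₀ + t(x - p₀)) = t² hsq(x)`. [folklore] -/
theorem hsq_ray (z₀ t : ℝ) (x : (EuclideanSpace ℝ (Fin 3))) :
    hsq (axisPt z₀ + t • (x - axisPt z₀)) = t ^ 2 * hsq x := by
  simp [hsq, axisPt]; ring

/-- `vc` is constant along rays from `p₀` (`t > 0`). [folklore] -/
theorem vcos_ray (z₀ : ℝ) {t : ℝ} (ht : 0 < t) (x : (EuclideanSpace ℝ (Fin 3))) :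
    vcos z₀ (axisPt z₀ + t • (x - axisPt z₀)) = vcos z₀ x := by
  unfold vcos
  rw [prad_ray z₀ ht.le]
  by_cases hx : x = axisPt z₀
  · subst hx; simp [prad]
  · have hR := prad_pos hx
    have : (axisPt z₀ + t • (x - axisPt z₀)) 2 - z₀ = t * (x 2 - z₀) := by simp
    rw [this, mul_div_mul_left _ _ ht.ne']

/-- `hs` is constant along rays from `p₀` (`t > 0`). [folklore] -/
theorem hsin2_ray (z₀ : ℝ) {t : ℝ} (ht : 0 < t) (x : (EuclideanSpace ℝ (Fin 3))) :
    hsin2 z₀ (axisPt z₀ + t • (x - axisPt z₀)) = hsin2 z₀ x := by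
  unfold hsin2
  rw [prad_ray z₀ ht.le, hsq_ray, mul_pow, mul_div_mul_left _ _ (pow_ne_zero 2 ht.ne')]

/-- `T̃` is constant along rays from `p₀`. [folklore] -/
theorem planePolar_ray (z₀ d c : ℝ) {t : ℝ} (ht : 0 < t) (x : (EuclideanSpace ℝ (Fin 3))) :
    planePolar z₀ d c (axisPt z₀ + t • (x - axisPt z₀)) = planePolar z₀ d c x := by
  unfold planePolar; rw [vcos_ray z₀ ht]

/-- `g̃` is constant along rays from `p₀`. [folklore] -/
theorem cylPolar_ray (z₀ ρ₁ c' : ℝ) {t : ℝ} (ht : 0 < t) (x : (EuclideanSpace ℝ (Fin 3))) :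
    cylPolar z₀ ρ₁ c' (axisPt z₀ + t • (x - axisPt z₀)) = cylPolar z₀ ρ₁ c' x := by
  unfold cylPolar; rw [hsin2_ray z₀ ht]

/-- **A function constant along rays has zero radial derivative.** [folklore] -/
theorem fderiv_apply_sub_axisPt_eq_zero {z₀ : ℝ} {f : (EuclideanSpace ℝ (Fin 3)) → ℝ}
    {x : (EuclideanSpace ℝ (Fin 3))} (hf : DifferentiableAt ℝ f x)
    (hray : ∀ t : ℝ, 0 < t → f (axisPt z₀ + t • (x - axisPt z₀)) = f x) :
    fderiv ℝ f x (x - axisPt z₀) = 0 := by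
  -- the curve `t ↦ f (p₀ + t (x - p₀))` is constant near `t = 1`
  have hγ : HasDerivAt (fun t : ℝ => axisPt z₀ + t • (x - axisPt z₀)) (x - axisPt z₀) 1 := by
    have := ((hasDerivAt_id (1 : ℝ)).smul_const (x - axisPt z₀)).const_add (axisPt z₀)
    simpa using this
  have hx1 : axisPt z₀ + (1 : ℝ) • (x - axisPt z₀) = x := by simp
  have hcomp : HasDerivAt (fun t : ℝ => f (axisPt z₀ + t • (x - axisPt z₀)))
      (fderiv ℝ f x (x - axisPt z₀)) 1 := by
    have hf' : HasFDerivAt f (fderiv ℝ f x) (axisPt z₀ + (1 : ℝ) • (x - axisPt z₀)) := by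
      rw [hx1]; exact hf.hasFDerivAt
    exact hf'.comp_hasDerivAt 1 hγ
  have hconst : (fun t : ℝ => f (axisPt z₀ + t • (x - axisPt z₀))) =ᶠ[𝓝 1] fun _ => f x := by
    filter_upwards [Ioi_mem_nhds (show (0 : ℝ) < 1 by norm_num)] with t ht using hray t ht
  have h0 : HasDerivAt (fun t : ℝ => f (axisPt z₀ + t • (x - axisPt z₀))) 0 1 :=
    (hasDerivAt_const (1 : ℝ) (f x)).congr_of_eventuallyEq hconst
  exact hcomp.unique h0

/-- Radial derivative of `T̃` vanishes (off `p₀`, `c > 0`). [folklore] -/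
theorem fderiv_planePolar_apply_sub_axisPt (hc : 0 < c) {x : (EuclideanSpace ℝ (Fin 3))}
    (hx : x ≠ axisPt z₀) :
    fderiv ℝ (planePolar z₀ d c) x (x - axisPt z₀) = 0 :=
  fderiv_apply_sub_axisPt_eq_zero ((contDiffAt_planePolar hc hx).differentiableAt (by simp))
    fun t ht => planePolar_ray z₀ d c ht x

/-- Radial derivative of `g̃` vanishes (off `p₀`, `c > 0`). [folklore] -/
theorem fderiv_cylPolar_apply_sub_axisPt (hc : 0 < c) {x : (EuclideanSpace ℝ (Fin 3))}
    (hx : x ≠ axisPt z₀) :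
    fderiv ℝ (cylPolar z₀ ρ₁ c) x (x - axisPt z₀) = 0 :=
  fderiv_apply_sub_axisPt_eq_zero ((contDiffAt_cylPolar hc hx).differentiableAt (by simp))
    fun t ht => cylPolar_ray z₀ ρ₁ c ht x

/-- Radial derivative of the rounded profile vanishes. [folklore] -/
theorem fderiv_polarProfile_apply_sub_axisPt (hP : ContDiff ℝ ∞ P) (hc : 0 < c) (hc' : 0 < c')
    {x : (EuclideanSpace ℝ (Fin 3))} (hx : x ≠ axisPt z₀) :
    fderiv ℝ (polarProfile P z₀ d ρ₁ c c' δᵣ) x (x - axisPt z₀) = 0 :=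
  fderiv_apply_sub_axisPt_eq_zero ((contDiffAt_polarProfile hP hc hc' hx).differentiableAt (by simp))
    fun t ht => by unfold polarProfile; rw [cylPolar_ray z₀ ρ₁ c' ht, planePolar_ray z₀ d c ht]

/-- **A function homogeneous of degree one along rays has radial derivative equal to its
value.** [folklore] -/
theorem fderiv_apply_sub_axisPt_eq_self {z₀ : ℝ} {f : (EuclideanSpace ℝ (Fin 3)) → ℝ}
    {x : (EuclideanSpace ℝ (Fin 3))} (hf : DifferentiableAt ℝ f x)
    (hray : ∀ t : ℝ, 0 < t → f (axisPt z₀ + t • (x - axisPt z₀)) = t * f x) :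
    fderiv ℝ f x (x - axisPt z₀) = f x := by
  have hγ : HasDerivAt (fun t : ℝ => axisPt z₀ + t • (x - axisPt z₀)) (x - axisPt z₀) 1 := by
    have := ((hasDerivAt_id (1 : ℝ)).smul_const (x - axisPt z₀)).const_add (axisPt z₀)
    simpa using this
  have hx1 : axisPt z₀ + (1 : ℝ) • (x - axisPt z₀) = x := by simp
  have hcomp : HasDerivAt (fun t : ℝ => f (axisPt z₀ + t • (x - axisPt z₀)))
      (fderiv ℝ f x (x - axisPt z₀)) 1 := by
    have hf' : HasFDerivAt f (fderiv ℝ f x) (axisPt z₀ + (1 : ℝ) • (x - axisPt z₀)) := by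
      rw [hx1]; exact hf.hasFDerivAt
    exact hf'.comp_hasDerivAt 1 hγ
  have hlin : (fun t : ℝ => f (axisPt z₀ + t • (x - axisPt z₀))) =ᶠ[𝓝 1] fun t => t * f x := by
    filter_upwards [Ioi_mem_nhds (show (0 : ℝ) < 1 by norm_num)] with t ht using hray t ht
  have h1 : HasDerivAt (fun t : ℝ => f (axisPt z₀ + t • (x - axisPt z₀))) (f x) 1 := by
    have := ((hasDerivAt_id (1 : ℝ)).mul_const (f x)).congr_of_eventuallyEq hlin
    simpa using this
  exact hcomp.unique h1

/-- **Radial derivative of `R` is `R`.** [folklore] -/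
theorem fderiv_prad_apply_sub_axisPt {x : (EuclideanSpace ℝ (Fin 3))} (hx : x ≠ axisPt z₀) :
    fderiv ℝ (prad z₀) x (x - axisPt z₀) = prad z₀ x :=
  fderiv_apply_sub_axisPt_eq_self ((contDiffAt_prad hx).differentiableAt (by simp))
    fun t ht => prad_ray z₀ ht.le x

end CappedBallLid

end Literature.Topology.FourManifolds

end
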